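import Summits.NavierStokesRegularity.NavierStokesRegularity.Theses.AxisymmetricExtremality
import Literature.Analysis.FluidPDE.AxisymmetricEuler
import Literature.Analysis.FluidPDE.KatoMaximalTime
import HarnessLib

/-!
# Strategist s20-g8 (family `-s`, independent census) — typed statements for `STRATEGY-CENSUS-s20-g8.md`

Crux `AxisymmetricExtremality.AxisymmetricKatoGlobal` (item stmt-NavierStokesRegularity-15453), route
`route-NavierStokesRegularity-AxisymmetricExtremality`.  This scratch file only TYPES the candidate
intermediate statements discussed in the census and proves the pure-logic relations among them; it
registers nothing (no `stub_`, no line).  Sections: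

* §1 `ThresholdInstance` (W₀) — the weakest drop-in replacement of the crux that the route's deciding
  theorem tolerates: "no axisymmetric Ḣ^{1/2}-MINIMAL blow-up datum".  Proved here: crux → W₀ and
  `MinimalDatumPFold → PFoldToAxisymmetric → W₀ → NavierStokesRegularity` (the route's `closes` with
  h₃ weakened to W₀; same five lines of logic).
* §2 `OneSidedRadialBound` (R) / `PartialTypeIToSwirlModulus` (Z) — the 2026 "partial Type I" cut
  (Q. S. Zhang, arXiv:2604.07785 Thm 1.1, stated there for Leray–Hopf solutions with
  `v₀ ∈ L² ∩ L^∞ ∩ C³`, `Γ₀ ∈ L^∞`; typed here in the Kato frame of the registered stub — NOT in print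
  in this form) and the proved composition `Z → R → SwirlAxisModulus` (= the registered
  `stub_swirlAxisModulus` statement, copied verbatim).
* §3 `QuantSwirlModulus` (S⁺) — the quantitative strengthening of the axis modulus.
-/

noncomputable section

open Set MeasureTheory Filter Topology Function Metric
open scoped ENNReal NNReal
open Literature.Analysis.FluidPDE Literature.Analysis.FunctionSpaces

-- `<Problem> = <Summit>` duplicates a namespace component by design.
set_option linter.dupNamespace false
set_option linter.unusedVariables false

namespace Summit.NavierStokesRegularity.NavierStokesRegularity.Cruxes.AxisymmetricKatoGlobal.StrategistS20g8

open Summit.NavierStokesRegularity.NavierStokesRegularity.Theses.AxisymmetricExtremality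

local notation "ℝ³" => EuclideanSpace ℝ (Fin 3)

/-! ## §0 The route's rotation-equivariance clause -/

/-- The rotation-equivariance clause written out in the route file (about the `x 2`-axis). -/
def RotEquivariant (u₀ : ℝ³ → ℝ³) : Prop :=
  ∀ (θ : ℝ) (x : ℝ³), u₀ (WithLp.toLp 2 ![Real.cos θ * x 0 - Real.sin θ * x 1,
      Real.sin θ * x 0 + Real.cos θ * x 1, x 2]) =
    WithLp.toLp 2 ![Real.cos θ * u₀ x 0 - Real.sin θ * u₀ x 1,
      Real.sin θ * u₀ x 0 + Real.cos θ * u₀ x 1, u₀ x 2]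

/-- It is definitionally `IsAxisymmetric`. -/
theorem rotEquivariant_iff (u₀ : ℝ³ → ℝ³) : RotEquivariant u₀ ↔ IsAxisymmetric u₀ := Iff.rfl

/-! ## §1 The threshold instance W₀ (summit-down weakest replacement) -/

/-- **W₀ — threshold instance of the crux.**  For every `ν > 0` there is NO axisymmetric
`Ḣ^{1/2}`-minimal blow-up datum (`IsMinimalBlowupDatum ν u₀ g`: `u₀ ∈ L³`, represented by `g`,
weakly divergence free, `‖g‖ = ρ_max^pure(ν)`, no global Kato solution).  This is exactly what the
route's `closes` consumes from h₃. -/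
def ThresholdInstance : Prop :=
  ∀ ν : ℝ, 0 < ν → ¬ ∃ (u₀ : ℝ³ → ℝ³)
      (g : HomSobolev ℝ³ (EuclideanSpace ℂ (Fin 3)) (1 / 2 : ℝ)),
      IsMinimalBlowupDatum ν u₀ g ∧ RotEquivariant u₀

/-- crux ⇒ W₀ (one line: a minimal blow-up datum is an axisymmetric critical datum without a global
Kato solution). -/
theorem thresholdInstance_of_crux (h : AxisymmetricKatoGlobal) : ThresholdInstance := by
  intro ν hν ⟨u₀, g, hmin, hax⟩
  obtain ⟨hL3, hrep, hdiv, -, hnot⟩ := hmin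
  exact hnot (h ν hν u₀ g hL3 hrep hdiv hax)

/-- W₀ is a drop-in replacement of h₃ in the route's deciding theorem (same logic as `closes`). -/
theorem closes_of_thresholdInstance (h₂ : MinimalDatumPFold) (h₄ : PFoldToAxisymmetric)
    (h₃ : ThresholdInstance) : NavierStokesRegularity := by
  show Literature.NS.NavierStokesExistenceSmoothR3
  intro ν hν u₀ hsm hdiv hdec
  by_contra hno
  obtain ⟨u₁, g, hmin, hax⟩ := h₄ ν hν (h₂ ν hν ⟨u₀, hsm, hdiv, hdec, hno⟩)
  exact h₃ ν hν ⟨u₁, g, hmin, hax⟩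

/-! ## §2 The partial-Type-I cut (2026) in the Kato frame of the registered stub -/

/-- The common hypothesis frame of the registered stubs: a Kato solution `u` on `[0,T)` of an
`Ḣ^{1/2}`-represented datum, smooth on `(0,T) × ℝ³`, with axisymmetric slices; conclusion `P`. -/
def InKatoFrame (P : ℝ → ℝ → (ℝ → ℝ³ → ℝ³) → Prop) : Prop :=
  ∀ ν : ℝ, 0 < ν → ∀ T : ℝ, 0 < T → ∀ (u₀ : ℝ³ → ℝ³)
    (g : HomSobolev ℝ³ (EuclideanSpace ℂ (Fin 3)) (1 / 2 : ℝ)) (u : ℝ → ℝ³ → ℝ³),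
    g.Represents (Literature.Analysis.FunctionSpaces.EuclideanSpace.complexify ∘ u₀) →
    IsKatoSolutionOn T ν u₀ u → ContDiffOn ℝ (⊤ : ℕ∞) (uncurry u) (Ioo 0 T ×ˢ univ) →
    (∀ t ∈ Ioo 0 T, IsAxisymmetric (u t)) → P ν T u

/-- The logarithmic axis modulus of the swirl on `[t₀, T)` (conclusion of `stub_swirlAxisModulus`). -/
def LogSwirlModulusOn (T : ℝ) (u : ℝ → ℝ³ → ℝ³) (t₀ : ℝ) : Prop :=
  ∃ C δ₀ : ℝ, 0 < δ₀ ∧ δ₀ < 1 ∧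
    ∀ t ∈ Ico t₀ T, ∀ x : ℝ³, cylRadius x ≤ δ₀ →
      |swirl (u t) x| ≤ C / |Real.log (cylRadius x)| ^ 3

/-- The one-sided ("partial Type I") bound on the radial velocity on `[t₀, T)`:
`u_r(t,x) ≥ -c/√(T-t)` (Zhang 2026, condition (c) of Thm 1.1). -/
def OneSidedRadialOn (T : ℝ) (u : ℝ → ℝ³ → ℝ³) (t₀ : ℝ) : Prop :=
  ∃ c : ℝ, ∀ t ∈ Ico t₀ T, ∀ x : ℝ³, -c / Real.sqrt (T - t) ≤ radialVelocity (u t) x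

/-- **SwirlAxisModulus** — verbatim the statement of the registered stub `stub_swirlAxisModulus`. -/
def SwirlAxisModulus : Prop :=
  ∀ ν : ℝ, 0 < ν → ∀ T : ℝ, 0 < T → ∀ (u₀ : ℝ³ → ℝ³)
    (g : HomSobolev ℝ³ (EuclideanSpace ℂ (Fin 3)) (1 / 2 : ℝ)) (u : ℝ → ℝ³ → ℝ³),
    g.Represents (Literature.Analysis.FunctionSpaces.EuclideanSpace.complexify ∘ u₀) →
    IsKatoSolutionOn T ν u₀ u → ContDiffOn ℝ (⊤ : ℕ∞) (uncurry u) (Ioo 0 T ×ˢ univ) →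
    (∀ t ∈ Ioo 0 T, IsAxisymmetric (u t)) →
    ∀ t₀ ∈ Ioo 0 T, ∃ C δ₀ : ℝ, 0 < δ₀ ∧ δ₀ < 1 ∧
      ∀ t ∈ Ico t₀ T, ∀ x : ℝ³, cylRadius x ≤ δ₀ →
        |swirl (u t) x| ≤ C / |Real.log (cylRadius x)| ^ 3

/-- It is the frame instance of `LogSwirlModulusOn`. -/
theorem swirlAxisModulus_iff :
    SwirlAxisModulus ↔ InKatoFrame fun _ T u => ∀ t₀ ∈ Ioo 0 T, LogSwirlModulusOn T u t₀ := Iff.rfl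

/-- **R — the a-priori one-sided radial bound** (the open half of the 2026 cut): in the Kato frame,
on every `[t₀,T)` the radial velocity is bounded below by `-c/√(T-t)`.  Trivial for `T < T_max`
(boundedness), content at `T = T_max`; implied by the crux (global ⇒ bounded on `[t₀,T]`). -/
def OneSidedRadialBound : Prop :=
  InKatoFrame fun _ T u => ∀ t₀ ∈ Ioo 0 T, OneSidedRadialOn T u t₀

/-- **Z — the partial-Type-I criterion in the Kato frame** (after Zhang, arXiv:2604.07785 Thm 1.1,
which is stated for Leray–Hopf solutions with `L² ∩ L^∞ ∩ C³` data and bounded `Γ₀`, and proves a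
Hölder axis modulus `|Γ| ≤ C r^α`, a fortiori the logarithmic one): one-sided radial control on
`[t₀,T)` forces the logarithmic axis modulus of the swirl on `[t₁,T)` for every later `t₁`. -/
def PartialTypeIToSwirlModulus : Prop :=
  InKatoFrame fun _ T u => ∀ t₀ ∈ Ioo 0 T, OneSidedRadialOn T u t₀ →
    ∀ t₁ ∈ Ioo t₀ T, LogSwirlModulusOn T u t₁

/-- The 2026 cut composes to the registered stub by pure logic: `Z → R → SwirlAxisModulus`. -/
theorem swirlAxisModulus_of_partialTypeI (hZ : PartialTypeIToSwirlModulus)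
    (hR : OneSidedRadialBound) : SwirlAxisModulus := by
  intro ν hν T hT u₀ g u hrep hu hsm hax t₁ ht₁
  -- pick an earlier time `t₀ = t₁/2 ∈ (0,T)` for the one-sided bound, then apply the criterion
  have ht₀ : t₁ / 2 ∈ Ioo 0 T := ⟨by linarith [ht₁.1], by linarith [ht₁.1, ht₁.2]⟩
  have hR' := hR ν hν T hT u₀ g u hrep hu hsm hax (t₁ / 2) ht₀
  exact hZ ν hν T hT u₀ g u hrep hu hsm hax (t₁ / 2) ht₀ hR' t₁ ⟨by linarith [ht₁.1], ht₁.2⟩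

/-! ## §3 The quantitative strengthening S⁺ -/

/-- **S⁺ — quantitative axis modulus.**  There is ONE modulus function `ω`, depending only on
`ν`, the swirl bound `‖Γ(t₀)‖_∞` and `‖u(t₀)‖_∞`-type data at the restart time (abstracted as two
real parameters), with `ω(r) → 0` as `r → 0⁺`, that bounds `|Γ|` at the axis up to `T` for every
solution in the Kato frame.  Strictly stronger than `SwirlAxisModulus` (uniformity); recorded to
show that the strengthening exposes no induction/compactness handle (census §Strengthen). -/
def QuantSwirlModulus : Prop :=
  ∃ ω : ℝ → ℝ → ℝ → ℝ → ℝ,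
    (∀ ν A B : ℝ, Tendsto (fun r => ω ν A B r) (nhdsWithin 0 (Ioi 0)) (nhds 0)) ∧
    InKatoFrame fun ν T u => ∀ t₀ ∈ Ioo 0 T, ∀ A B : ℝ,
      (∀ x : ℝ³, |swirl (u t₀) x| ≤ A) → (∀ x : ℝ³, ‖u t₀ x‖ ≤ B) →
      ∀ t ∈ Ico t₀ T, ∀ x : ℝ³, cylRadius x < 1 → |swirl (u t) x| ≤ ω ν A B (cylRadius x)

end Summit.NavierStokesRegularity.NavierStokesRegularity.Cruxes.AxisymmetricKatoGlobal.StrategistS20g8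

end
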